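import Mathlib
import HarnessLib
import Summits.HubbardSuperconductivity.HubbardSuperconductivity.Theorems.KLProgrammeKLRegimeTwoVolumeLipProfilesOfTower
import Summits.HubbardSuperconductivity.HubbardSuperconductivity.Theorems.KLProgrammeKLRegimeTwoVolumeLipDiffSups

/-!
# Route `KLProgramme` — crux K3 ENGINE (stmt-HubbardSuperconductivity-20437), stub (e) proof-input «(e)-D-ROWS»: THE DEEP-PIN SIZE OF THE MEASURED DIFFERENCE IS AT
# MOST ITS WEIGHTED GLOBAL PROFILE — `bE ≤ bD`, so the majorant `bV + bD + bE` of the Lipschitz step has E1's four-piece rows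
# (seat hubbard-kl-k3c4-p1 g24; `--supports` 20437; DROWS-SCOPE-g24 v10 §12.2 N4 / §12.3)

The profile-form Lipschitz tower (`EngineV8.towerBornDiff_le_law_of_profile_tok`) needs the four-piece rows of the common majorant `μb k = bV + bD + bE`
(`…TwoVolumeLipBornDiffHstep`).  `bV`, `bD` are E1's one-volume weighted measured arrays at the two volumes (`…TwoVolumeLipProfilesOfTower`); this file bounds the
third array by the second: the tree weight is `≥ 1` (`IsTreeWeight.one_le`), so the UNWEIGHTED pinned sum of the measured difference at any pin is at most its
`klGluedWt`-weighted pinned sum, hence `klLipInputDiffSup … m R ≤ ε·(klTowerMeasWt (bL) … d k m + klTowerMeasWt L … d k m)` for every depth `R` — no new datum.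

* `sum_pinned_norm_kernel_le_wt` (drop a tree weight), **`klLipInputDiffSup_le_towerMeasWt`**.

Pure bookkeeping over landed theorems; nothing asserts the (D) rows, stub (e), VL, K3 or superconductivity.
-/

noncomputable section

namespace Summit.HubbardSuperconductivity.HubbardSuperconductivity.Theorems.TwoVolumeLip

set_option linter.dupNamespace false -- summit = problem name (single-conjunct summit), D-0017

open Finset Literature.MathematicalPhysics.QuantumLattice GrassmannAlgebra Literature.Probability.LatticeModels
  Literature.Probability.LatticeModels.BattleFederbush
open Literature.MathematicalPhysics.QuantumLattice.FermiRG
open Summit.HubbardSuperconductivity.HubbardSuperconductivity.Theorems.KLRegimeSplit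
open Summit.HubbardSuperconductivity.HubbardSuperconductivity.Theorems.KLProgrammeLegKernels
open Summit.HubbardSuperconductivity.HubbardSuperconductivity.Theorems.DispersionFlow
open Summit.HubbardSuperconductivity.HubbardSuperconductivity.Theorems.EngineV8
open Summit.HubbardSuperconductivity.HubbardSuperconductivity.Theorems.TwoVolumeSource
open Summit.HubbardSuperconductivity.HubbardSuperconductivity.Theorems.TwoVolumeDefect

/-- **Dropping a tree weight**: for `wt ≥ 1` a plain pinned sum is at most the weighted one. -/
theorem sum_pinned_norm_kernel_le_wt {Γ : Type*} [Fintype Γ] [DecidableEq Γ] (T : GrassmannAlgebra ℂ Γ) {m : ℕ} (j : Fin m) (x : Γ)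
    (wt : Finset Γ → ℝ) (hwt : ∀ S, 1 ≤ wt S) :
    ∑ Y ∈ univ.filter (fun Y : Fin m → Γ => Y j = x), ‖kernel ℂ T m Y‖ ≤
      ∑ Y ∈ univ.filter (fun Y : Fin m → Γ => Y j = x), ‖kernel ℂ T m Y‖ * wt (univ.image Y) :=
  sum_le_sum fun _ _ => le_mul_of_one_le_right (norm_nonneg _) (hwt _)

variable {L b M : ℕ} [NeZero L] [NeZero (b * L)] [NeZero M]

/-- **`bE ≤ bD`**: for every depth `R` and degree `m`, `klLipInputDiffSup L b M β U μ K d k m R ≤ ε·(klTowerMeasWt (bL) … d k m + klTowerMeasWt L … d k m)` (`0 ≤ β`). -/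
theorem klLipInputDiffSup_le_towerMeasWt {β : ℝ} (hβ : 0 ≤ β) (U μ : ℝ) (K : TrigPolyC4v) (d k m R : ℕ) :
    klLipInputDiffSup L b M β U μ K d k m R ≤
      imagTimeWeight β M * (klTowerMeasWt (b * L) M β U μ K d k m + klTowerMeasWt L M β U μ K d k m) := by
  have h0 : 0 ≤ imagTimeWeight β M * (klTowerMeasWt (b * L) M β U μ K d k m + klTowerMeasWt L M β U μ K d k m) :=
    mul_nonneg (imagTimeWeight_nonneg hβ M) (add_nonneg (klTowerMeasWt_nonneg hβ U μ K d k m) (klTowerMeasWt_nonneg hβ U μ K d k m))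
  refine klLipInputDiffSup_le_of_forall β U μ K d k m R h0 fun q w _ => ?_
  exact (sum_pinned_norm_kernel_le_wt _ q w _
    (isTreeWeight_klGluedWt (L := L) (b := b) (M := M) hβ (d * k - 1) (sectorCount (d * k - 1))).one_le).trans
    (inputDiff_wt_profile_le_towerMeasWt hβ U μ K d k q w)

end Summit.HubbardSuperconductivity.HubbardSuperconductivity.Theorems.TwoVolumeLip

end
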